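import Literature.AlgebraicGeometry.Motives.TateAbelianFiniteCubeProofs
import Literature.AlgebraicGeometry.Motives.TateAbelianFiniteLatticeProofs
import Literature.AlgebraicGeometry.Motives.AbelianVarietyFrobeniusSemisimpleDescent
import Literature.NumberTheory.DiophantineGeometry.AVIsogenyTateOfCubeProofs
import Literature.NumberTheory.DiophantineGeometry.AVIsogenyTateHomCubicalProofs
import HarnessLib

/-!
# Tate's Main Theorem over a finite field from the Theorem of the Cube, Poincaré reducibility
# over `K̄`, and finiteness of isomorphism classes WITHIN THE ISOGENY CLASS of `A ⊞ B`

J. Tate, *Endomorphisms of abelian varieties over finite fields*, Invent. Math. 2 (1966),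
Main Theorem: for abelian varieties `A`, `B` over a finite field `k` and a prime `ℓ ≠ char k`,
`ℤ_ℓ ⊗ Hom_k(A, B) → Hom_{Gal(k̄/k)}(T_ℓ A, T_ℓ B)` is bijective (the named facts
`tate_bijective_of_finite A B ℓ`, `tate_end_bijective_of_finite A ℓ` of `Motives/TateAbelianFinite`).

Tate's proof (§§1–3; Milne, *The Work of John Tate*, §4.3; Milne, *Abelian Varieties* (2008),
Ch. IV, Lemma 2.4 and Thm. 2.5) uses finiteness of `k`-isomorphism classes only for the abelian
varieties `B_n` met along an `ℓ`-power isogeny tower of `A × B` — all ISOGENOUS to `A × B` — and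
the tree's perfect-field form of Tate's method, `faltingsTateMap_bijective_of_exists_infinite_iso`
(`Motives/TateAbelianFiniteCubeProofs`), takes exactly this hypothesis:

  (∞-iso) in every sequence of abelian varieties over `K` isogenous to `A ⊞ B`, infinitely many
  terms are mutually isomorphic.

The assemblies landed so far combine (∞-iso) with Poincaré's theorem over `K` itself
(`tate_bijective_of_finite_of_exists_infinite_iso_of_theoremOfCube_of_poincare`), or Poincaré over
`K̄` with the stronger finiteness `finite_isoClasses_of_finite K (dim (A ⊞ B))` (Milne 1986,
Cor. 18.9: all abelian varieties of that dimension;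
`tate_bijective_of_finite_of_theoremOfCube_of_poincare_algebraicClosure`,
`Motives/AbelianVarietyEndGaloisFinite`). This file records the sharper combination now available:

* `tate_bijective_of_finite_of_exists_infinite_iso_of_theoremOfCube_of_poincare_algebraicClosure` —
  **`tate_bijective_of_finite A B ℓ` from the Theorem of the Cube (`theoremOfCube_linEquiv`),
  Poincaré's complete reducibility theorem for abelian varieties over `K̄` (`hP1`, Mumford §19
  Thm. 1), and (∞-iso) for the isogeny class of `A ⊞ B` only.** The remaining Mumford §19 inputs
  come from the cube alone: `Hom(A, B)` finitely generated and the Tate map injective without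
  Poincaré (`faltingsTateMap_injective_of_theoremOfCube`, `finiteDimensional_endAlgebra_of_theoremOfCube`,
  `NumberTheory/DiophantineGeometry/AVIsogenyTateOfCubeProofs`, via positive curve forms), and the
  semisimplicity of `End⁰_K(A ⊞ B)` by Mumford §19 Cor. 2 over `K̄` descended to the finite field
  `K` through the Frobenius (`AbelianVariety.isSemisimpleRing_endAlgebra_of_theoremOfCube_of_poincare_algebraicClosure`,
  `Motives/AbelianVarietyFrobeniusSemisimpleDescent`, Tate 1966 §1); quotients are
  `exists_quotient_isogeny_holds`.
* `tate_end_bijective_of_finite_of_exists_infinite_iso_of_theoremOfCube_of_poincare_algebraicClosure`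
  — the `End` form, i.e. the named fact of this cluster, `tate_end_bijective_of_finite A ℓ`, from
  the cube, `hP1` over `K̄` and (∞-iso) for the isogeny class of `A ⊞ A`;
* the same two from `cechComplex_pseudoCoherent_general` (Görtz–Wedhorn II Thm. 23.133, from
  which the tree proves the Theorem of the Cube, `theoremOfCube_linEquiv_of_pseudoCoherent_general`);
* `tate_bijective_of_finite_of_exists_infinite_iso_of_cubicalStructure_of_poincare_algebraicClosure`,
  `tate_end_bijective_of_finite_of_exists_infinite_iso_of_cubicalStructure_of_poincare_algebraicClosure`,
  `tate_bijective_of_finite_of_cubicalStructure_of_poincare_algebraicClosure`,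
  `tate_end_bijective_of_finite_of_cubicalStructure_of_poincare_algebraicClosure` — the same four
  conclusions with the global Theorem of the Cube replaced by **the cubical structure of the single
  abelian variety `(A ⊞ B)_K̄`** (Görtz–Wedhorn II, Prop. 27.167 for `(A ⊞ B)_K̄`, the hypothesis
  `((A ⊞ B).baseChange K̄).cubicalStructure_linEquiv`), which is the form in which the cube is
  being discharged in this directory one projective scheme at a time
  (`Motives/AbelianVarietyCubeProofs`, `Motives/CechPseudoCoherentAt*`): finite generation of
  `End((A ⊞ B)_K̄)` and `End_K(A ⊞ B)` from that cubical structure alone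
  (`module_finite_hom_of_cubicalStructure(_of_isAlgClosed)`,
  `NumberTheory/DiophantineGeometry/AVIsogenyTateHomCubicalProofs`), then
  `faltingsTateMap_injective_of_module_finite_hom`, `finiteDimensional_endAlgebra_of_module_finite_hom`,
  Mumford §19 Cor. 2 over `K̄` (`isSemisimpleRing_endAlgebra_of_mumford19` with
  `hsimple_of_isAlgClosed`) and its Frobenius descent
  (`isSemisimpleRing_endAlgebra_of_baseChange_algebraicClosure`).

So the trust base of `tate_end_bijective_of_finite A ℓ` is now: the cubical structure of
`(A ⊞ A)_K̄` (Görtz–Wedhorn II Prop. 27.167, a consequence of the Theorem of the Cube for the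
projective scheme `(A ⊞ A)_K̄ ×_K̄ (A ⊞ A)_K̄ ×_K̄ (A ⊞ A)_K̄`), Poincaré reducibility over the
algebraically closed field `K̄`, and (∞-iso) within the isogeny class of `A ⊞ A` over the finite
field `K` — the last being Tate's hypothesis "Hyp(k, A × A, ℓ)" in the
form he verifies it for finite `k` (finiteness of `k`-forms of bounded-degree polarised abelian
varieties, §1 of the paper; Milne 1986 Cor. 18.9 implies it, `AbelianVariety.exists_infinite_iso_of_finite_isoClasses_of_finite_of_isIsogenous`).

No definition and no named fact is introduced (D-0026); theorems only, one-line compositions.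

## References

* [Tate1966Endomorphisms] J. Tate, *Endomorphisms of abelian varieties over finite fields*,
  Invent. Math. 2 (1966), 134–144, Main Theorem and §§1–3 — not held (doi:10.1007/bf01404549);
  statement and architecture as reported in Milne, *The Work of John Tate*, §4.3, 4.3.1
  (arXiv:1210.7459, held, pp. 22–23) and Kieffer 2024, Thm. 1.2.11 (held, p. 26).
* [MilneAV2008] J. S. Milne, *Abelian Varieties* (course notes, 2008), Ch. IV, Lemma 2.4 and
  Thm. 2.5 (pp. 137–138).
* [MumfordAV1970] D. Mumford, *Abelian Varieties* (1970), §19 Thm. 1, Cor. 2, Thm. 3.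
* [Milne1986AbelianVarieties] J. S. Milne, *Abelian Varieties*, in Cornell–Silverman (1986),
  Cor. 18.9 (held, PDF p. 212).
-/

noncomputable section

universe u

open CategoryTheory CategoryTheory.Limits AlgebraicGeometry

namespace Literature.AlgebraicGeometry.Motives

open AbelianVariety

variable {K : Type u} [Field K] (A B : AbelianVariety K) (ℓ : ℕ) [Fact ℓ.Prime]

/-- **Tate 1966, Main Theorem (`Hom` form) over a finite field, from the Theorem of the Cube,
Poincaré's complete reducibility theorem over `K̄`, and (∞-iso) within the isogeny class of
`A ⊞ B`.** For abelian varieties `A`, `B` over a field `K` and a prime `ℓ`: if the Theorem of the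
Cube holds (`hcube`), every abelian subvariety of an abelian variety over `K̄` has an isogeny
complement (`hP1`, Mumford §19 Thm. 1), and, when `K` is finite, in every sequence of abelian
varieties over `K` isogenous to `A ⊞ B` infinitely many terms are mutually isomorphic (`hiso`),
then `tate_bijective_of_finite A B ℓ`: for `K` finite and `(ℓ : K) ≠ 0` the Tate map
`ℤ_ℓ ⊗ Hom_K(A, B) → Hom_{Γ_K}(T_ℓ A, T_ℓ B)` is bijective. Proof: Tate's method over the perfect
field `K` (`faltingsTateMap_bijective_of_exists_infinite_iso`, Milne AV IV 2.4–2.5) for the bicone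
`A ⊞ B`, fed with `exists_quotient_isogeny_holds`, `finiteDimensional_endAlgebra_of_theoremOfCube`,
the Frobenius descent `isSemisimpleRing_endAlgebra_of_theoremOfCube_of_poincare_algebraicClosure`
of Mumford §19 Cor. 2 from `K̄` to `K` (Tate 1966 §1), and `faltingsTateMap_injective_of_theoremOfCube`.
[cite: Tate1966Endomorphisms, Main Theorem] -/
theorem tate_bijective_of_finite_of_exists_infinite_iso_of_theoremOfCube_of_poincare_algebraicClosure
    (hcube : theoremOfCube_linEquiv.{u})
    (hP1 : ∀ (X Y : AbelianVariety (AlgebraicClosure K)) (i : Y ⟶ X),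
      IsClosedImmersion (Hom.toSchemeHom i) → 0 < Y.dim → Y.dim < X.dim →
      ∃ (Z : AbelianVariety (AlgebraicClosure K)) (j : Z ⟶ X),
        IsClosedImmersion (Hom.toSchemeHom j) ∧ IsIsogeny (biprod.desc i j))
    (hiso : ∀ [Finite K], ∀ C : ℕ → AbelianVariety K, (∀ n, IsIsogenous (C n) (A ⊞ B)) →
      ∃ S : Set ℕ, S.Infinite ∧ ∀ m ∈ S, ∀ n ∈ S, Nonempty (C m ≅ C n)) :
    tate_bijective_of_finite A B ℓ := by
  intro _ hℓ
  haveI : PerfectField K := PerfectField.ofFinite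
  exact faltingsTateMap_bijective_of_exists_infinite_iso ℓ hℓ (BinaryBiproduct.bicone A B) hiso
    (exists_quotient_isogeny_holds (A ⊞ B) ℓ) (finiteDimensional_endAlgebra_of_theoremOfCube hcube (A ⊞ B))
    (isSemisimpleRing_endAlgebra_of_theoremOfCube_of_poincare_algebraicClosure hcube hP1 (A ⊞ B))
    (faltingsTateMap_injective_of_theoremOfCube hcube A B ℓ hℓ)

/-- **Tate 1966, Main Theorem (`End` form) over a finite field — the named fact
`tate_end_bijective_of_finite A ℓ` from the Theorem of the Cube, Poincaré reducibility over `K̄`,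
and (∞-iso) within the isogeny class of `A ⊞ A` over the finite field `K`** (the `Hom` form for
`(A, A)`, `tate_end_bijective_of_finite_of`). [cite: Tate1966Endomorphisms, Main Theorem] -/
theorem tate_end_bijective_of_finite_of_exists_infinite_iso_of_theoremOfCube_of_poincare_algebraicClosure
    (hcube : theoremOfCube_linEquiv.{u})
    (hP1 : ∀ (X Y : AbelianVariety (AlgebraicClosure K)) (i : Y ⟶ X),
      IsClosedImmersion (Hom.toSchemeHom i) → 0 < Y.dim → Y.dim < X.dim →
      ∃ (Z : AbelianVariety (AlgebraicClosure K)) (j : Z ⟶ X),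
        IsClosedImmersion (Hom.toSchemeHom j) ∧ IsIsogeny (biprod.desc i j))
    (hiso : ∀ [Finite K], ∀ C : ℕ → AbelianVariety K, (∀ n, IsIsogenous (C n) (A ⊞ A)) →
      ∃ S : Set ℕ, S.Infinite ∧ ∀ m ∈ S, ∀ n ∈ S, Nonempty (C m ≅ C n)) :
    tate_end_bijective_of_finite A ℓ :=
  tate_end_bijective_of_finite_of A ℓ
    (tate_bijective_of_finite_of_exists_infinite_iso_of_theoremOfCube_of_poincare_algebraicClosure
      A A ℓ hcube hP1 hiso)

/-- **Tate 1966, Main Theorem (`Hom` form) over a finite field from the pseudo-coherence of the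
Čech complex** (`cechComplex_pseudoCoherent_general`, Görtz–Wedhorn II Thm. 23.133 / Cor. 23.135 —
the leaf from which the tree proves the Theorem of the Cube,
`theoremOfCube_linEquiv_of_pseudoCoherent_general`), Poincaré reducibility over `K̄`, and (∞-iso)
within the isogeny class of `A ⊞ B`. [cite: Tate1966Endomorphisms, Main Theorem] -/
theorem tate_bijective_of_finite_of_exists_infinite_iso_of_pseudoCoherent_general_of_poincare_algebraicClosure
    (h : cechComplex_pseudoCoherent_general.{u})
    (hP1 : ∀ (X Y : AbelianVariety (AlgebraicClosure K)) (i : Y ⟶ X),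
      IsClosedImmersion (Hom.toSchemeHom i) → 0 < Y.dim → Y.dim < X.dim →
      ∃ (Z : AbelianVariety (AlgebraicClosure K)) (j : Z ⟶ X),
        IsClosedImmersion (Hom.toSchemeHom j) ∧ IsIsogeny (biprod.desc i j))
    (hiso : ∀ [Finite K], ∀ C : ℕ → AbelianVariety K, (∀ n, IsIsogenous (C n) (A ⊞ B)) →
      ∃ S : Set ℕ, S.Infinite ∧ ∀ m ∈ S, ∀ n ∈ S, Nonempty (C m ≅ C n)) :
    tate_bijective_of_finite A B ℓ :=
  tate_bijective_of_finite_of_exists_infinite_iso_of_theoremOfCube_of_poincare_algebraicClosure A B ℓ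
    (theoremOfCube_linEquiv_of_pseudoCoherent_general h) hP1 hiso

/-- **Tate 1966, Main Theorem (`End` form) over a finite field — trust base of the named fact
`tate_end_bijective_of_finite A ℓ` after this file**: `cechComplex_pseudoCoherent_general` (i.e. the
Theorem of the Cube), Poincaré's complete reducibility theorem over the algebraically closed field
`K̄`, and (∞-iso) within the isogeny class of `A ⊞ A` over the finite field `K` (Tate's
hypothesis Hyp for `A × A`; implied by Milne 1986 Cor. 18.9,
`AbelianVariety.exists_infinite_iso_of_finite_isoClasses_of_finite_of_isIsogenous`).
[cite: Tate1966Endomorphisms, Main Theorem] -/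
theorem tate_end_bijective_of_finite_of_exists_infinite_iso_of_pseudoCoherent_general_of_poincare_algebraicClosure
    (h : cechComplex_pseudoCoherent_general.{u})
    (hP1 : ∀ (X Y : AbelianVariety (AlgebraicClosure K)) (i : Y ⟶ X),
      IsClosedImmersion (Hom.toSchemeHom i) → 0 < Y.dim → Y.dim < X.dim →
      ∃ (Z : AbelianVariety (AlgebraicClosure K)) (j : Z ⟶ X),
        IsClosedImmersion (Hom.toSchemeHom j) ∧ IsIsogeny (biprod.desc i j))
    (hiso : ∀ [Finite K], ∀ C : ℕ → AbelianVariety K, (∀ n, IsIsogenous (C n) (A ⊞ A)) →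
      ∃ S : Set ℕ, S.Infinite ∧ ∀ m ∈ S, ∀ n ∈ S, Nonempty (C m ≅ C n)) :
    tate_end_bijective_of_finite A ℓ :=
  tate_end_bijective_of_finite_of_exists_infinite_iso_of_theoremOfCube_of_poincare_algebraicClosure
    A ℓ (theoremOfCube_linEquiv_of_pseudoCoherent_general h) hP1 hiso

/-! ### From the cubical structure of `(A ⊞ B)_K̄` alone -/

/-- **Tate 1966, Main Theorem (`Hom` form) over a finite field from the cubical structure of
`(A ⊞ B)_K̄`, Poincaré reducibility over `K̄`, and (∞-iso) within the isogeny class of `A ⊞ B`.**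
As `tate_bijective_of_finite_of_exists_infinite_iso_of_theoremOfCube_of_poincare_algebraicClosure`,
with the global Theorem of the Cube replaced by Görtz–Wedhorn II Prop. 27.167 for the single abelian
variety `(A ⊞ B)_K̄` (`hc`): `End((A ⊞ B)_K̄)` and `End_K(A ⊞ B)` are finitely generated from `hc`
(`module_finite_hom_of_cubicalStructure_of_isAlgClosed`, `module_finite_hom_of_cubicalStructure`;
Mumford §19 Thm. 3 via positive curve forms), whence `Hom_K(A, B)` is
(`module_finite_hom_of_module_finite_end_biprod`), the Tate map is injective
(`faltingsTateMap_injective_of_module_finite_hom`), `End⁰(A ⊞ B)` is finite-dimensional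
(`finiteDimensional_endAlgebra_of_module_finite_hom`) and semisimple (Mumford §19 Cor. 2 over `K̄`,
`isSemisimpleRing_endAlgebra_of_mumford19` with `hsimple_of_isAlgClosed`, descended through the
Frobenius, `isSemisimpleRing_endAlgebra_of_baseChange_algebraicClosure`); conclude by
`faltingsTateMap_bijective_of_exists_infinite_iso`. [cite: Tate1966Endomorphisms, Main Theorem]
[cite: GortzWedhorn2023, Prop. 27.167 (p. 877)] -/
theorem tate_bijective_of_finite_of_exists_infinite_iso_of_cubicalStructure_of_poincare_algebraicClosure
    (hc : ((A ⊞ B).baseChange (AlgebraicClosure K)).cubicalStructure_linEquiv)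
    (hP1 : ∀ (X Y : AbelianVariety (AlgebraicClosure K)) (i : Y ⟶ X),
      IsClosedImmersion (Hom.toSchemeHom i) → 0 < Y.dim → Y.dim < X.dim →
      ∃ (Z : AbelianVariety (AlgebraicClosure K)) (j : Z ⟶ X),
        IsClosedImmersion (Hom.toSchemeHom j) ∧ IsIsogeny (biprod.desc i j))
    (hiso : ∀ [Finite K], ∀ C : ℕ → AbelianVariety K, (∀ n, IsIsogenous (C n) (A ⊞ B)) →
      ∃ S : Set ℕ, S.Infinite ∧ ∀ m ∈ S, ∀ n ∈ S, Nonempty (C m ≅ C n)) :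
    tate_bijective_of_finite A B ℓ := by
  intro _ hℓ
  haveI : PerfectField K := PerfectField.ofFinite
  haveI : Module.Finite ℤ (End ((A ⊞ B).baseChange (AlgebraicClosure K))) :=
    Literature.NumberTheory.DiophantineGeometry.module_finite_hom_of_cubicalStructure_of_isAlgClosed hc
  have hfg : module_finite_hom (A ⊞ B) (A ⊞ B) := module_finite_hom_of_cubicalStructure (A ⊞ B) (A ⊞ B) hc
  haveI : Module.Finite ℤ (End (A ⊞ B)) := hfg
  exact faltingsTateMap_bijective_of_exists_infinite_iso ℓ hℓ (BinaryBiproduct.bicone A B) hiso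
    (exists_quotient_isogeny_holds (A ⊞ B) ℓ) (finiteDimensional_endAlgebra_of_module_finite_hom (A ⊞ B) hfg)
    (isSemisimpleRing_endAlgebra_of_baseChange_algebraicClosure (A ⊞ B)
      (isSemisimpleRing_endAlgebra_of_mumford19 hP1 (hsimple_of_isAlgClosed (AlgebraicClosure K)) _))
    (faltingsTateMap_injective_of_module_finite_hom A B
      (module_finite_hom_of_module_finite_end_biprod hfg) ℓ hℓ)

/-- **Tate 1966, Main Theorem (`End` form) over a finite field — the named fact
`tate_end_bijective_of_finite A ℓ` from the cubical structure of `(A ⊞ A)_K̄`, Poincaré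
reducibility over `K̄`, and (∞-iso) within the isogeny class of `A ⊞ A`.**
[cite: Tate1966Endomorphisms, Main Theorem] -/
theorem tate_end_bijective_of_finite_of_exists_infinite_iso_of_cubicalStructure_of_poincare_algebraicClosure
    (hc : ((A ⊞ A).baseChange (AlgebraicClosure K)).cubicalStructure_linEquiv)
    (hP1 : ∀ (X Y : AbelianVariety (AlgebraicClosure K)) (i : Y ⟶ X),
      IsClosedImmersion (Hom.toSchemeHom i) → 0 < Y.dim → Y.dim < X.dim →
      ∃ (Z : AbelianVariety (AlgebraicClosure K)) (j : Z ⟶ X),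
        IsClosedImmersion (Hom.toSchemeHom j) ∧ IsIsogeny (biprod.desc i j))
    (hiso : ∀ [Finite K], ∀ C : ℕ → AbelianVariety K, (∀ n, IsIsogenous (C n) (A ⊞ A)) →
      ∃ S : Set ℕ, S.Infinite ∧ ∀ m ∈ S, ∀ n ∈ S, Nonempty (C m ≅ C n)) :
    tate_end_bijective_of_finite A ℓ :=
  tate_end_bijective_of_finite_of A ℓ
    (tate_bijective_of_finite_of_exists_infinite_iso_of_cubicalStructure_of_poincare_algebraicClosure
      A A ℓ hc hP1 hiso)

/-- **Tate 1966, Main Theorem (`Hom` form) over a finite field from the cubical structure of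
`(A ⊞ B)_K̄`, Poincaré reducibility over `K̄`, and Milne 1986 Cor. 18.9** in dimension
`dim (A ⊞ B)` (`finite_isoClasses_of_finite`, which gives (∞-iso) for the isogeny class of `A ⊞ B`
by `exists_infinite_iso_of_finite_isoClasses_of_finite_of_isIsogenous`).
[cite: Tate1966Endomorphisms, Main Theorem] -/
theorem tate_bijective_of_finite_of_cubicalStructure_of_poincare_algebraicClosure
    (hc : ((A ⊞ B).baseChange (AlgebraicClosure K)).cubicalStructure_linEquiv)
    (hP1 : ∀ (X Y : AbelianVariety (AlgebraicClosure K)) (i : Y ⟶ X),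
      IsClosedImmersion (Hom.toSchemeHom i) → 0 < Y.dim → Y.dim < X.dim →
      ∃ (Z : AbelianVariety (AlgebraicClosure K)) (j : Z ⟶ X),
        IsClosedImmersion (Hom.toSchemeHom j) ∧ IsIsogeny (biprod.desc i j))
    (hfin : finite_isoClasses_of_finite K (A ⊞ B).dim) :
    tate_bijective_of_finite A B ℓ :=
  tate_bijective_of_finite_of_exists_infinite_iso_of_cubicalStructure_of_poincare_algebraicClosure
    A B ℓ hc hP1
    (fun C hC ↦ exists_infinite_iso_of_finite_isoClasses_of_finite_of_isIsogenous (A ⊞ B) hfin C hC)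

/-- **Tate 1966, Main Theorem (`End` form) over a finite field — the named fact
`tate_end_bijective_of_finite A ℓ` from the cubical structure of `(A ⊞ A)_K̄`, Poincaré
reducibility over `K̄`, and `finite_isoClasses_of_finite K (dim (A ⊞ A))` (Milne 1986 Cor. 18.9).**
The discharge `tate_end_bijective_of_finite_holds` is this theorem applied to the cubical structure
of `(A ⊞ A)_K̄`, Poincaré's theorem over `K̄` and `finite_isoClasses_of_finite_holds K _` once those
land. [cite: Tate1966Endomorphisms, Main Theorem] -/
theorem tate_end_bijective_of_finite_of_cubicalStructure_of_poincare_algebraicClosure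
    (hc : ((A ⊞ A).baseChange (AlgebraicClosure K)).cubicalStructure_linEquiv)
    (hP1 : ∀ (X Y : AbelianVariety (AlgebraicClosure K)) (i : Y ⟶ X),
      IsClosedImmersion (Hom.toSchemeHom i) → 0 < Y.dim → Y.dim < X.dim →
      ∃ (Z : AbelianVariety (AlgebraicClosure K)) (j : Z ⟶ X),
        IsClosedImmersion (Hom.toSchemeHom j) ∧ IsIsogeny (biprod.desc i j))
    (hfin : finite_isoClasses_of_finite K (A ⊞ A).dim) :
    tate_end_bijective_of_finite A ℓ :=
  tate_end_bijective_of_finite_of A ℓ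
    (tate_bijective_of_finite_of_cubicalStructure_of_poincare_algebraicClosure A A ℓ hc hP1 hfin)

end Literature.AlgebraicGeometry.Motives
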